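import Summits.Ventures.PackingBounds.Energy.TenPointCkSix
import Summits.Ventures.PackingBounds.Energy.GramCongrFaces
import Summits.Ventures.PackingBounds.Energy.ThreePointEnergyDeficit
import HarnessLib

/-!
# Ten points on `S³`, potential `(1+⟪x,y⟫)^6`: every minimiser is a `{0, (√5-1)/4, -(√5+1)/4}`-code (rigidity from the SOS face)

Framing: lottery ticket; floor = certified bounds/negative ranges. Venture `PackingBounds`, cell
`pub-packcert`, energy family E3PT (pub-packcert-energy gen 15; n = 4, d = 8 kernel route = KERNEL-D6 double data route, size-split, list-route SOS bridge).

If ten unit vectors `C ⊂ ℝ⁴` attain `Σ_{x≠y} (1+⟪x,y⟫)^6 = 1205/8`, the deficit identity (`ThreePointDeficit.energy_sub_bound_eq`)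
makes the slack of the three-point inequality vanish at every ordered triple of distinct points; the slack is `(1/K)·mᵀ X m`
(`slack_bridgeW6`), `X = P (S·Y) Pᵀ` with `S·Y ≻ 0` WITH MARGIN (`GramData.checkDDm`, kernel), so every face form `Σ_a P_{ai} m_a` vanishes
(`GramData.faces_vanish_of_congr`); the face-basis vector read off column 0 of the data (`GramData.checkCol`) is the univariate
`t³ + t²/2 - t/4 = t (t - (√5-1)/4) (t + (√5+1)/4)`, so every inner product of distinct points is `0`, `cos 72° = (√5-1)/4` or
`cos 144° = -(√5+1)/4` — the inner products of two orthogonal regular pentagons.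
-/

noncomputable section

open Finset
open scoped RealInnerProductSpace

namespace Summit.Ventures.PackingBounds.Energy.TenPointCkSix

open Literature.Geometry.DiscreteGeometry Literature.Geometry.DiscreteGeometry.BachocVallentin
open Literature.Analysis.SpecialFunctions Summit.Ventures.PackingBounds.Energy
open Summit.Ventures.PackingBounds.Energy.GramData Summit.Ventures.PackingBounds.Energy.PentagonsSixD8

set_option maxRecDepth 100000 in
set_option maxHeartbeats 0 in
/-- The remainder `E` of `S·Y = L Lᵀ + E` is diagonally dominant with margin `1` (kernel evaluation): `S·Y ≻ 0`. -/
theorem ddm_oneW6 : checkDDm 153 1 eW6 = true := by decide +kernel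

/-- Column 0 of the scaled face-basis matrix `bW6`: `256·(t³ + t²/2 - t/4)` on the monomials `t, t², t³`. -/
def faceColW6 : List ℤ := [0, -64, 128, 256, 0, 0, 0, 0, 0, 0, 0, 0, 0, 0, 0, 0, 0, 0, 0, 0, 0, 0, 0, 0, 0, 0, 0, 0, 0, 0, 0, 0, 0, 0, 0, 0, 0, 0, 0, 0, 0, 0, 0, 0, 0, 0, 0, 0, 0, 0, 0, 0, 0, 0, 0, 0, 0, 0, 0, 0, 0, 0, 0, 0, 0, 0, 0, 0, 0, 0, 0, 0, 0, 0, 0, 0, 0, 0, 0, 0, 0, 0, 0, 0, 0, 0, 0, 0, 0, 0, 0, 0, 0, 0, 0, 0, 0, 0, 0, 0, 0, 0, 0, 0, 0, 0, 0, 0, 0, 0, 0, 0, 0, 0, 0, 0, 0, 0, 0, 0, 0, 0, 0, 0, 0, 0, 0, 0, 0, 0, 0, 0, 0, 0, 0, 0, 0, 0, 0, 0, 0, 0, 0, 0, 0, 0, 0, 0, 0, 0, 0, 0, 0, 0, 0, 0, 0, 0, 0, 0, 0, 0, 0, 0, 0]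

set_option maxRecDepth 100000 in
set_option maxHeartbeats 0 in
/-- `faceColW6` is column 0 of `bW6` (kernel evaluation). -/
theorem faceCol_okW6 : checkCol 165 bW6 0 faceColW6 = true := by decide +kernel

set_option maxRecDepth 100000 in
set_option maxHeartbeats 0 in
/-- If the monomial-side form `mᵀ X m` vanishes at `(u,v,t)`, then `t ∈ {0, (√5-1)/4, -(√5+1)/4}`. -/
theorem t_of_listQuad_eq_zeroW6 (u v t : ℝ) (h0 : listQuad (mvecW6 u v t) xW6 0 = 0) :
    t = 0 ∨ t = (-1 + Real.sqrt 5) / 4 ∨ t = (-1 - Real.sqrt 5) / 4 := by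
  have hXlen : xW6.length = 165 := by decide
  have hXrow : ∀ m, m < 165 → (xW6.getD m []).length = 165 := by decide +kernel
  have hB : ∀ a, a < 165 → (bW6.getD a []).length = 153 := by decide +kernel
  have hv := faces_vanish_of_congr 165 153 153 1 le_rfl bW6 yW6 xW6 lW6 eW6 hXlen hXrow hB congrW6_all rowsW6_all
    (of_checkDDm ddm_oneW6) (mvecW6 u v t) h0 ⟨0, by norm_num⟩
  have hv' : ∑ a : Fin 165, (ent bW6 a 0 : ℝ) * mvecW6 u v t a = 0 := hv
  rw [sum_ent_eq_linForm faceCol_okW6 (by decide) (mvecW6 u v t)] at hv'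
  have hm1 : mvecW6 u v t 1 = t := rfl
  have hm2 : mvecW6 u v t 2 = t ^ (2 : ℕ) := rfl
  have hm3 : mvecW6 u v t 3 = t ^ (3 : ℕ) := rfl
  simp only [linForm, faceColW6, Nat.reduceAdd, Int.cast_zero, zero_mul, zero_add, add_zero, hm1, hm2, hm3] at hv'
  push_cast at hv'
  have hX : Real.sqrt 5 ^ 2 = 5 := Real.sq_sqrt (by norm_num)
  have hf : t * ((t - (-1 + Real.sqrt 5) / 4) * (t - (-1 - Real.sqrt 5) / 4)) = 0 := by
    linear_combination (1 / ((256 : ℝ)) : ℝ) * hv' - (t / 16) * hX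
  rcases mul_eq_zero.1 hf with h | h
  · exact Or.inl h
  · rcases mul_eq_zero.1 h with h | h
    · exact Or.inr (Or.inl (by linarith))
    · exact Or.inr (Or.inr (by linarith))

/-- **Rigidity of the `(1+t)^6`-energy ground state of ten points on `S³`.** If ten unit vectors of `ℝ⁴` attain
`Σ_{x≠y} (1+⟪x,y⟫)^6 = 1205/8`, then every inner product of two distinct points is `0`, `(√5-1)/4` or `-(√5+1)/4`. -/
theorem ck6_ten_points_rigid (C : Finset (EuclideanSpace ℝ (Fin 4))) (hC : ∀ x ∈ C, ‖x‖ = 1)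
    (h10 : C.card = 10)
    (hmin : ∑ x ∈ C, ∑ y ∈ C.erase x, (1 + inner ℝ x y) ^ 6 = ((1205 : ℝ)/8)) :
    ∀ x ∈ C, ∀ y ∈ C, x ≠ y → inner ℝ x y = 0 ∨ inner ℝ x y = (-1 + Real.sqrt 5) / 4 ∨ inner ℝ x y = (-1 - Real.sqrt 5) / 4 := by
  classical
  have hA := pairSum_gegenbauer_comb_nonneg (n := 4) (by norm_num) 6 acoKW6 aco_nonnegW6 C hC
  have hF := tripleSum_threePointF_nonneg (n := 4) le_rfl 8 8 dcoKW6 dco_nonnegW6 gwKW6 C hC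
  have hcard : (C.card : ℝ) = 10 := by exact_mod_cast h10
  have hAeval : ∀ w : ℝ, (∑ k ∈ range (6 + 1), acoKW6 k * gegenbauerSum ((((4 : ℕ) : ℝ) - 2) / 2) k w) = aPolyKW6 w := by
    intro w
    have hμ : ((((4 : ℕ) : ℝ) - 2) / 2) = (1 : ℝ) := by norm_num
    rw [hμ]
    have h0 : acoKW6 0 = 0 := rfl
    have h1 : acoKW6 1 = (((6814616631068721967371495631 : ℝ)/2566587662908602169253953536000)) / 2 := rfl
    have h2 : acoKW6 2 = (((4445946204988965639336761 : ℝ)/15209408372791716558541946880)) / 3 := rfl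
    have h3 : acoKW6 3 = (((257439904114432818217 : ℝ)/892604438945577566208000)) / 4 := rfl
    have h4 : acoKW6 4 = 0 := rfl
    have h5 : acoKW6 5 = 0 := rfl
    have h6 : acoKW6 6 = (((5856977620022894247907 : ℝ)/20369743356417477533761536)) / 7 := rfl
    simp only [Finset.sum_range_succ, Finset.sum_range_zero, h0, h1, h2, h3, h4, h5, h6, ChebyshevU.c1_0, ChebyshevU.c1_1, ChebyshevU.c1_2, ChebyshevU.c1_3, ChebyshevU.c1_4, ChebyshevU.c1_5, ChebyshevU.c1_6, aPolyKW6]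
    ring
  have hineq : ∀ u v t : ℝ, -1 ≤ u → u < 1 → -1 ≤ v → v < 1 → -1 ≤ t → t < 1 →
      0 ≤ 1 + 2 * u * v * t - u ^ 2 - v ^ 2 - t ^ 2 →
      c0KW6 + ((C.card : ℝ) - 2) * threePointF 4 8 8 dcoKW6 gwKW6 u v t + threePointF 4 8 8 dcoKW6 gwKW6 u u 1
        + threePointF 4 8 8 dcoKW6 gwKW6 v v 1 + threePointF 4 8 8 dcoKW6 gwKW6 t t 1
        + ((fun w => ∑ k ∈ range (6 + 1), acoKW6 k * gegenbauerSum ((((4 : ℕ) : ℝ) - 2) / 2) k w) u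
          + (fun w => ∑ k ∈ range (6 + 1), acoKW6 k * gegenbauerSum ((((4 : ℕ) : ℝ) - 2) / 2) k w) v
          + (fun w => ∑ k ∈ range (6 + 1), acoKW6 k * gegenbauerSum ((((4 : ℕ) : ℝ) - 2) / 2) k w) t) / 3
        ≤ (pminKW6 u + pminKW6 v + pminKW6 t) / 3 := by
    intro u v t hu1 hu2 hv1 hv2 ht1 ht2 hdet
    simp only [hAeval, hcard, threePointF_eqW6]
    have h1 := slack_nonnegW6 u v t
    linarith
  have hEp : ∑ x ∈ C, ∑ y ∈ C.erase x, pminKW6 (inner ℝ x y) = ((1205 : ℝ)/8) := by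
    rw [← hmin]
    refine Finset.sum_congr rfl fun x _ => Finset.sum_congr rfl fun y _ => ?_
    simp only [pminKW6]; ring
  have hsharp : ∑ x ∈ C, ∑ y ∈ C.erase x, pminKW6 (inner ℝ x y)
      = (C.card : ℝ) * (((C.card : ℝ) - 1) * c0KW6 - threePointF 4 8 8 dcoKW6 gwKW6 1 1 1 - (fun w => ∑ k ∈ range (6 + 1), acoKW6 k * gegenbauerSum ((((4 : ℕ) : ℝ) - 2) / 2) k w) 1) := by
    simp only [hAeval, hcard, threePointF_eqW6]
    rw [hEp, ← bound_eqW6]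
  obtain ⟨hA0, hF0⟩ := ThreePointDeficit.pairSum_eq_zero_of_sharp C hC (by omega) pminKW6 _ _ c0KW6 hA hF
    (threePointF_swap12 4 8 8 dcoKW6 gwKW6) (threePointF_swap23 4 8 8 dcoKW6 gwKW6) hineq hsharp
  have hid := ThreePointDeficit.energy_sub_bound_eq C hC (by omega) pminKW6 (fun w => ∑ k ∈ range (6 + 1), acoKW6 k * gegenbauerSum ((((4 : ℕ) : ℝ) - 2) / 2) k w)
    (threePointF 4 8 8 dcoKW6 gwKW6) c0KW6
    (threePointF_swap12 4 8 8 dcoKW6 gwKW6) (threePointF_swap23 4 8 8 dcoKW6 gwKW6)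
  rw [hsharp, sub_self, hA0, hF0, add_zero, add_zero] at hid
  have hrange : ∀ x ∈ C, ∀ y ∈ C, x ≠ y → -1 ≤ inner ℝ x y ∧ inner ℝ x y < 1 := by
    intro x hx y hy hxy
    refine ⟨neg_one_le_real_inner_of_norm_eq_one (hC x hx) (hC y hy),
      lt_of_le_of_ne (real_inner_le_one_of_norm_eq_one (hC x hx) (hC y hy)) ?_⟩
    intro h1
    exact hxy ((inner_eq_one_iff_of_norm_eq_one (𝕜 := ℝ) (hC x hx) (hC y hy)).1 h1)
  set T : EuclideanSpace ℝ (Fin 4) → EuclideanSpace ℝ (Fin 4) → EuclideanSpace ℝ (Fin 4) → ℝ :=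
    fun x y z => ((pminKW6 (inner ℝ x y) + pminKW6 (inner ℝ x z) + pminKW6 (inner ℝ y z))
        - (3 * c0KW6 + 3 * (((C.card : ℝ) - 2) * threePointF 4 8 8 dcoKW6 gwKW6 (inner ℝ x y) (inner ℝ x z) (inner ℝ y z))
          + 3 * (threePointF 4 8 8 dcoKW6 gwKW6 (inner ℝ x y) (inner ℝ x y) 1
            + threePointF 4 8 8 dcoKW6 gwKW6 (inner ℝ x z) (inner ℝ x z) 1
            + threePointF 4 8 8 dcoKW6 gwKW6 (inner ℝ y z) (inner ℝ y z) 1)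
          + ((fun w => ∑ k ∈ range (6 + 1), acoKW6 k * gegenbauerSum ((((4 : ℕ) : ℝ) - 2) / 2) k w) (inner ℝ x y)
            + (fun w => ∑ k ∈ range (6 + 1), acoKW6 k * gegenbauerSum ((((4 : ℕ) : ℝ) - 2) / 2) k w) (inner ℝ x z)
            + (fun w => ∑ k ∈ range (6 + 1), acoKW6 k * gegenbauerSum ((((4 : ℕ) : ℝ) - 2) / 2) k w) (inner ℝ y z))))
    with hTdef
  have hTnn : ∀ x ∈ C, ∀ y ∈ C.erase x, ∀ z ∈ (C.erase x).erase y, 0 ≤ T x y z := by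
    intro x hx y hy z hz
    have hyC : y ∈ C := Finset.mem_of_mem_erase hy
    have hxy : x ≠ y := fun h => (Finset.ne_of_mem_erase hy) h.symm
    have hz1 : z ∈ C.erase x := Finset.mem_of_mem_erase hz
    have hzC : z ∈ C := Finset.mem_of_mem_erase hz1
    have hzy : z ≠ y := Finset.ne_of_mem_erase hz
    have hzx : z ≠ x := Finset.ne_of_mem_erase hz1
    obtain ⟨lo1, hi1⟩ := hrange x hx y hyC hxy
    obtain ⟨lo2, hi2⟩ := hrange x hx z hzC hzx.symm
    obtain ⟨lo3, hi3⟩ := hrange y hyC z hzC hzy.symm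
    have h0 := hineq _ _ _ lo1 hi1 lo2 hi2 lo3 hi3
      (BachocVallentin.gram3_nonneg x y z (hC x hx) (hC y hyC) (hC z hzC))
    simp only [hTdef]
    linarith
  have hSum0 : ∑ x ∈ C, ∑ y ∈ C.erase x, ∑ z ∈ (C.erase x).erase y, T x y z = 0 := by
    have hpos : (0 : ℝ) < 1 / (3 * ((C.card : ℝ) - 2)) := by rw [hcard]; norm_num
    have h := hid.symm
    simp only [hTdef]
    rcases mul_eq_zero.1 h with h1 | h1
    · exact absurd h1 hpos.ne'
    · exact h1
  have hT0 : ∀ x ∈ C, ∀ y ∈ C.erase x, ∀ z ∈ (C.erase x).erase y, T x y z = 0 := by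
    have h1 := (Finset.sum_eq_zero_iff_of_nonneg (fun x hx =>
      Finset.sum_nonneg fun y hy => Finset.sum_nonneg fun z hz => hTnn x hx y hy z hz)).1 hSum0
    intro x hx
    have h2 := (Finset.sum_eq_zero_iff_of_nonneg (fun y hy =>
      Finset.sum_nonneg fun z hz => hTnn x hx y hy z hz)).1 (h1 x hx)
    intro y hy
    exact (Finset.sum_eq_zero_iff_of_nonneg (fun z hz => hTnn x hx y hy z hz)).1 (h2 y hy)
  intro y hy z hz hyz
  have hcard3 : 0 < ((C.erase y).erase z).card := by
    rw [Finset.card_erase_of_mem (Finset.mem_erase.2 ⟨fun h => hyz h.symm, hz⟩),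
      Finset.card_erase_of_mem hy, h10]; norm_num
  obtain ⟨x, hx⟩ := Finset.card_pos.1 hcard3
  have hx1 : x ∈ C.erase y := Finset.mem_of_mem_erase hx
  have hxC : x ∈ C := Finset.mem_of_mem_erase hx1
  have hxz : x ≠ z := Finset.ne_of_mem_erase hx
  have hxy : x ≠ y := Finset.ne_of_mem_erase hx1
  have hy' : y ∈ C.erase x := Finset.mem_erase.2 ⟨fun h => hxy h.symm, hy⟩
  have hz' : z ∈ (C.erase x).erase y := Finset.mem_erase.2 ⟨fun h => hyz h.symm, Finset.mem_erase.2 ⟨fun h => hxz h.symm, hz⟩⟩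
  have hT := hT0 x hxC y hy' z hz'
  simp only [hTdef, hAeval, hcard, threePointF_eqW6] at hT
  set u := inner ℝ x y with hu
  set v := inner ℝ x z with hv
  set t := inner ℝ y z with ht
  have hs : (pminKW6 u + pminKW6 v + pminKW6 t) / 3 - (c0KW6 + 8 * FexpKW6 u v t + FexpKW6 u u 1 + FexpKW6 v v 1 + FexpKW6 t t 1
      + (aPolyKW6 u + aPolyKW6 v + aPolyKW6 t) / 3) = 0 := by
    linarith [hT]
  have hb := slack_bridgeW6 u v t
  rw [hs, mul_zero] at hb
  exact t_of_listQuad_eq_zeroW6 u v t hb.symm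

/-- **Balance of the `(1+t)^6`-energy ground state of ten points on `S³`.** If ten unit vectors of `ℝ⁴` attain
`Σ_{x≠y} (1+⟪x,y⟫)^6 = 1205/8`, then `Σ x = 0` (complementary slackness of the two-point part: `a₁ > 0`). -/
theorem ck6_ten_points_balanced (C : Finset (EuclideanSpace ℝ (Fin 4))) (hC : ∀ x ∈ C, ‖x‖ = 1)
    (h10 : C.card = 10)
    (hmin : ∑ x ∈ C, ∑ y ∈ C.erase x, (1 + inner ℝ x y) ^ 6 = ((1205 : ℝ)/8)) :
    ∑ x ∈ C, x = 0 := by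
  classical
  have hA := pairSum_gegenbauer_comb_nonneg (n := 4) (by norm_num) 6 acoKW6 aco_nonnegW6 C hC
  have hF := tripleSum_threePointF_nonneg (n := 4) le_rfl 8 8 dcoKW6 dco_nonnegW6 gwKW6 C hC
  have hcard : (C.card : ℝ) = 10 := by exact_mod_cast h10
  have hAeval : ∀ w : ℝ, (∑ k ∈ range (6 + 1), acoKW6 k * gegenbauerSum ((((4 : ℕ) : ℝ) - 2) / 2) k w) = aPolyKW6 w := by
    intro w
    have hμ : ((((4 : ℕ) : ℝ) - 2) / 2) = (1 : ℝ) := by norm_num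
    rw [hμ]
    have h0 : acoKW6 0 = 0 := rfl
    have h1 : acoKW6 1 = (((6814616631068721967371495631 : ℝ)/2566587662908602169253953536000)) / 2 := rfl
    have h2 : acoKW6 2 = (((4445946204988965639336761 : ℝ)/15209408372791716558541946880)) / 3 := rfl
    have h3 : acoKW6 3 = (((257439904114432818217 : ℝ)/892604438945577566208000)) / 4 := rfl
    have h4 : acoKW6 4 = 0 := rfl
    have h5 : acoKW6 5 = 0 := rfl
    have h6 : acoKW6 6 = (((5856977620022894247907 : ℝ)/20369743356417477533761536)) / 7 := rfl
    simp only [Finset.sum_range_succ, Finset.sum_range_zero, h0, h1, h2, h3, h4, h5, h6, ChebyshevU.c1_0, ChebyshevU.c1_1, ChebyshevU.c1_2, ChebyshevU.c1_3, ChebyshevU.c1_4, ChebyshevU.c1_5, ChebyshevU.c1_6, aPolyKW6]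
    ring
  have hineq : ∀ u v t : ℝ, -1 ≤ u → u < 1 → -1 ≤ v → v < 1 → -1 ≤ t → t < 1 →
      0 ≤ 1 + 2 * u * v * t - u ^ 2 - v ^ 2 - t ^ 2 →
      c0KW6 + ((C.card : ℝ) - 2) * threePointF 4 8 8 dcoKW6 gwKW6 u v t + threePointF 4 8 8 dcoKW6 gwKW6 u u 1
        + threePointF 4 8 8 dcoKW6 gwKW6 v v 1 + threePointF 4 8 8 dcoKW6 gwKW6 t t 1
        + ((fun w => ∑ k ∈ range (6 + 1), acoKW6 k * gegenbauerSum ((((4 : ℕ) : ℝ) - 2) / 2) k w) u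
          + (fun w => ∑ k ∈ range (6 + 1), acoKW6 k * gegenbauerSum ((((4 : ℕ) : ℝ) - 2) / 2) k w) v
          + (fun w => ∑ k ∈ range (6 + 1), acoKW6 k * gegenbauerSum ((((4 : ℕ) : ℝ) - 2) / 2) k w) t) / 3
        ≤ (pminKW6 u + pminKW6 v + pminKW6 t) / 3 := by
    intro u v t hu1 hu2 hv1 hv2 ht1 ht2 hdet
    simp only [hAeval, hcard, threePointF_eqW6]
    have h1 := slack_nonnegW6 u v t
    linarith
  have hEp : ∑ x ∈ C, ∑ y ∈ C.erase x, pminKW6 (inner ℝ x y) = ((1205 : ℝ)/8) := by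
    rw [← hmin]
    refine Finset.sum_congr rfl fun x _ => Finset.sum_congr rfl fun y _ => ?_
    simp only [pminKW6]; ring
  have hsharp : ∑ x ∈ C, ∑ y ∈ C.erase x, pminKW6 (inner ℝ x y)
      = (C.card : ℝ) * (((C.card : ℝ) - 1) * c0KW6 - threePointF 4 8 8 dcoKW6 gwKW6 1 1 1 - (fun w => ∑ k ∈ range (6 + 1), acoKW6 k * gegenbauerSum ((((4 : ℕ) : ℝ) - 2) / 2) k w) 1) := by
    simp only [hAeval, hcard, threePointF_eqW6]
    rw [hEp, ← bound_eqW6]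
  obtain ⟨hA0, -⟩ := ThreePointDeficit.pairSum_eq_zero_of_sharp C hC (by omega) pminKW6 _ _ c0KW6 hA hF
    (threePointF_swap12 4 8 8 dcoKW6 gwKW6) (threePointF_swap23 4 8 8 dcoKW6 gwKW6) hineq hsharp
  have hswap : BachocVallentin.pairSum C (fun w => ∑ k ∈ range (6 + 1), acoKW6 k * gegenbauerSum ((((4 : ℕ) : ℝ) - 2) / 2) k w)
      = ∑ k ∈ range (6 + 1), acoKW6 k * BachocVallentin.pairSum C (fun t => gegenbauerSum ((((4 : ℕ) : ℝ) - 2) / 2) k t) := by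
    simp only [BachocVallentin.pairSum, Finset.mul_sum]
    have h1 : ∀ x ∈ C, (∑ y ∈ C, ∑ k ∈ range (6 + 1),
        acoKW6 k * gegenbauerSum ((((4 : ℕ) : ℝ) - 2) / 2) k (inner ℝ x y)) =
        ∑ k ∈ range (6 + 1), ∑ y ∈ C, acoKW6 k * gegenbauerSum ((((4 : ℕ) : ℝ) - 2) / 2) k (inner ℝ x y) :=
      fun x _ => Finset.sum_comm
    rw [Finset.sum_congr rfl h1, Finset.sum_comm]
  rw [hswap] at hA0
  have hterm : ∀ k ∈ range (6 + 1), 0 ≤ acoKW6 k * BachocVallentin.pairSum C (fun t => gegenbauerSum ((((4 : ℕ) : ℝ) - 2) / 2) k t) :=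
    fun k _ => mul_nonneg (aco_nonnegW6 k) (pairSum_gegenbauer_nonneg (n := 4) (by norm_num) k C hC)
  have h1 := (Finset.sum_eq_zero_iff_of_nonneg hterm).1 hA0 1 (by simp)
  have ha1 : (0 : ℝ) < acoKW6 1 := by
    have h : acoKW6 1 = (((6814616631068721967371495631 : ℝ)/2566587662908602169253953536000)) / 2 := rfl
    rw [h]; norm_num
  have hP1 : BachocVallentin.pairSum C (fun t => gegenbauerSum ((((4 : ℕ) : ℝ) - 2) / 2) 1 t) = 0 := by
    rcases mul_eq_zero.1 h1 with h | h
    · exact absurd h ha1.ne'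
    · exact h
  have hfun : (fun t => gegenbauerSum ((((4 : ℕ) : ℝ) - 2) / 2) 1 t) = fun t => (2 : ℝ) * t := by
    funext t; rw [gegenbauerSum_one]; push_cast; ring
  rw [hfun] at hP1
  exact ThreePointDeficit.sum_eq_zero_of_sharp C 2 (by norm_num) hP1

end Summit.Ventures.PackingBounds.Energy.TenPointCkSix
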